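import Summits.BirchSwinnertonDyer.Rank1Residual.X2.GreenbergVatsalReductionDatumLine
import Summits.BirchSwinnertonDyer.Rank1Residual.X2.GreenbergVatsalTorsionInvariants
import Summits.BirchSwinnertonDyer.Rank1Residual.X1.CongruenceTransfer
import HarnessLib

/-!
# Greenberg–Vatsal's "the order of `S^{Σ₀}_{A_i[p]}(ℚ_∞)` is independent of `i`" for two
# `p`-congruent elliptic curves over `ℚ`, good ordinary at an odd `p` — EVERY hypothesis discharged:
# `#(S^{Σ₀}_{E₁[p^∞]}(ℚ_∞) ⊓ H¹[p]) = #(S^{Σ₀}_{E₂[p^∞]}(ℚ_∞) ⊓ H¹[p])` from `E₁[p] ≅ E₂[p]` alone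

HONEST FRAMING (cell `b2b-bsdres`, run/shared/lean/b2b/bsd-rank1-residual/, verbatim in every
file): the goal of the cell is to DELETE the COMBINATION-SHAPED residual classes of the
Birch–Swinnerton-Dyer formula for ALL analytic-rank `≤ 1` elliptic curves over `ℚ` — "full BSD
formula for every rank `≤ 1` curve in class `C`" assembled STRICTLY from published theorems — so
that the rank-`≤ 1` remainder becomes exactly the CONSTRUCTION-SHAPED classes, which are TYPED
(missing-input `Prop`s), NOT attempted. This is not "finishing BSD". Sub-cell
`b2b-bsdres-eisenstein-p2` (CLASS-OWNERS row "X2"), gen 9: research route; NO CLAIM BEYOND STATED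
CLASSES; nothing here changes a label. Theorems only (no `def`, no named fact, nothing asserted).

WHAT THIS FILE PROVES — the assembled kernel form of Greenberg–Vatsal p. 27 (arXiv:math/9906215):
"by proposition (2.8), we have `Sel^{Σ₀}_{E_i}(ℚ_∞)[p] = S^{Σ₀}_{A_i}(ℚ_∞)[p] ≅ S^{Σ₀}_{A_i[p]}(ℚ_∞)`.
Furthermore, the order of this group is independent of `i` since `A₁[p] ≅ A₂[p]` as `G_ℚ`-modules."
— WITHOUT GV's hypothesis `H⁰(ℚ, E_i[p]) = 0` (route G's `φ = 1` classes, flag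
`GV-Prop28-H0-remark`, referee R98.2/R102.2): for `E₁, E₂/ℚ` globally minimal, `p` ODD, both of
good ORDINARY reduction at `p` (anomalous allowed), `κ` the cyclotomic `ℤ_p`-extension, `Σ₀` any set
of primes containing the bad primes `≠ p` of BOTH curves, and `E₁[p] ≅ E₂[p]` as `Γ_ℚ`-modules
(eisenstein-p1's `X1.CongruenceTransfer.TorsionIso`, decided per pair by the census key):
**`#(S^{Σ₀}_{E₁[p^∞]}(ℚ_∞) ⊓ H¹(ℚ_∞,E₁[p^∞])[p]) = #(S^{Σ₀}_{E₂[p^∞]}(ℚ_∞) ⊓ H¹(ℚ_∞,E₂[p^∞])[p])`**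
for GREENBERG'S OWN data `C_i = ker(E_i[p^∞] → Ẽ_i)` (`natCard_gvSelmerInfty_inf_torsion_eq_of_torsionIso`).
Every hypothesis of the abstract transfer (gens 8–9: `TorsionComparison*`, `GreenbergVatsalTorsion*`,
`GreenbergVatsalTorsionInvariants`) is a TREE THEOREM here: continuity and `p`-divisibility of
`E[p^∞]` (`GreenbergVatsalTorsionCurve`), `Σ₀ ⊇ Ram(E[p^∞])` (Silverman VII.4.1(a),
`unramified_outside`), "`I_p` trivial on `D`" (`reductionData_htriv`), "`I_p` moves every point of
`C[p]`" (`reductionData_hgen`: Weil pairing + local Kronecker–Weber), finiteness of `E_i(ℚ_∞)[p^∞]`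
(Mazur 6.12, `finite_fixedPoints_kerSubgroup_geomPrimaryTorsion_of_ordinary`), and the `t`-terms
cancel (`natCard_torsionBy_invariants_eq`). WHAT STAYS PRINTED for route G: the passage from this
group order to `λ`: `#(S^{Σ₀}_A(ℚ_∞)[p]) = p^{λ(X^{Σ₀})}` at `μ = 0` (GV Prop. (2.8) second half via
Prop. (2.5) — no `H⁰` clause, p. 23/25), `λ(X^{Σ₀}) = λ(X) + Σ_{ℓ∈Σ₀} s_ℓ d_ℓ` (Cor. (2.3), Prop. (2.4))
and `Sel_E(ℚ_∞)_p = S_A(ℚ_∞)` (Greenberg LNM 1716 §2) — the suppliers of `CongruentLambdaShift`.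

References: Greenberg–Vatsal 2000, §2 Prop. (2.8), pp. 25–27; Greenberg, LNM 1716, §1 p. 62, §2.
-/

noncomputable section

open scoped Classical AddSubgroup

open NumberField IsDedekindDomain Field
open Literature.NumberTheory.EllipticCurves Literature.NumberTheory.EllipticCurves.GreenbergSelmer
  Literature.NumberTheory.GaloisRepresentations
  Summit.BirchSwinnertonDyer.Rank1Residual.X2.TorsionComparison
  Summit.BirchSwinnertonDyer.Rank1Residual.X2.GreenbergVatsalTorsion
  Summit.BirchSwinnertonDyer.Rank1Residual.X2.GreenbergVatsalTorsionCurve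
  Summit.BirchSwinnertonDyer.Rank1Residual.X2.GreenbergVatsalReductionDatum
  Summit.BirchSwinnertonDyer.Rank1Residual.X2.GreenbergVatsalReductionDatumLine
  Summit.BirchSwinnertonDyer.Rank1Residual.X2.GreenbergVatsalTorsionInvariants
open WeierstrassCurve (minimalDiscriminantInt)

namespace Summit.BirchSwinnertonDyer.Rank1Residual.X2.GreenbergVatsalTransferCurve

/-! ## §1. From `TorsionIso` (on `E[p] ⊆ E(ℚ̄)`) to an equivariant isomorphism of `E[p^∞][p]` -/

/-- The `p`-torsion of `E[p^∞]` and the `p`-torsion of `E(ℚ̄)` are the same points: an explicit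
additive bijection `E[p^∞][p] ≃ E[p]`, compatible with the Galois action (stated as `Nonempty` to
keep this file theorems-only). [folklore] -/
theorem nonempty_torsionBy_primaryTorsion_equiv (W : WeierstrassCurve ℚ) (p : ℕ) [Fact p.Prime] :
    ∃ j : (W.geomPrimaryTorsion p)[(p : ℤ)] ≃+ W.geomTorsion (p : ℤ),
      (∀ (g : absoluteGaloisGroup ℚ) (x : (W.geomPrimaryTorsion p)[(p : ℤ)]),
        ((j (g • x) : W.geomTorsion (p : ℤ)) : W.geomPoints) = g • ((j x : W.geomTorsion (p : ℤ)) :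
          W.geomPoints)) ∧
        ∀ y : W.geomTorsion (p : ℤ), (((j.symm y : (W.geomPrimaryTorsion p)[(p : ℤ)]) :
          W.geomPrimaryTorsion p) : W.geomPoints) = (y : W.geomPoints) := by
  refine ⟨{ toFun := fun x ↦ ⟨((x : W.geomPrimaryTorsion p) : W.geomPoints),
              AddSubgroup.torsionBy.nsmul_iff.mpr (by
                have h : p • (x : W.geomPrimaryTorsion p) = 0 := AddSubgroup.torsionBy.nsmul_iff.mp x.2
                have h' := congrArg (fun z : W.geomPrimaryTorsion p ↦ (z : W.geomPoints)) h
                simp only [AddSubgroupClass.coe_nsmul, ZeroMemClass.coe_zero] at h'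
                exact h')⟩
            invFun := fun y ↦ ⟨⟨(y : W.geomPoints), W.geomTorsion_le_geomPrimaryTorsion p y.2⟩,
              AddSubgroup.torsionBy.nsmul_iff.mpr (Subtype.ext (by
                have h : p • (y : W.geomPoints) = 0 := AddSubgroup.torsionBy.nsmul_iff.mp y.2
                simp only [AddSubgroupClass.coe_nsmul, ZeroMemClass.coe_zero]
                exact h))⟩
            left_inv := fun _ ↦ rfl
            right_inv := fun _ ↦ rfl
            map_add' := fun _ _ ↦ rfl }, fun g x ↦ rfl, fun y ↦ rfl⟩

/-- **From route G's `TorsionIso E₁ E₂ p` (a `Γ_ℚ`-isomorphism `E₁[p] ≅ E₂[p]`) to a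
`Γ_ℚ`-equivariant isomorphism `E₁[p^∞][p] ≃ E₂[p^∞][p]`** (the shape consumed by the kernel
transfer). [cite: GreenbergVatsal2000, Thm. (1.4) (hypothesis "E₁[p] ≅ E₂[p] as Galois modules", arXiv p. 5)] -/
theorem exists_equiv_of_torsionIso {W₁ W₂ : WeierstrassCurve ℚ} {p : ℕ} [Fact p.Prime]
    (h : X1.CongruenceTransfer.TorsionIso W₁ W₂ p) :
    ∃ θ : (W₁.geomPrimaryTorsion p)[(p : ℤ)] ≃+ (W₂.geomPrimaryTorsion p)[(p : ℤ)],
      ∀ (g : absoluteGaloisGroup ℚ) (m : (W₁.geomPrimaryTorsion p)[(p : ℤ)]),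
        θ (g • m) = g • θ m := by
  obtain ⟨e, he⟩ := h
  obtain ⟨j₁, hj₁, -⟩ := nonempty_torsionBy_primaryTorsion_equiv W₁ p
  obtain ⟨j₂, hj₂g, hj₂⟩ := nonempty_torsionBy_primaryTorsion_equiv W₂ p
  refine ⟨j₁.trans (e.trans j₂.symm), fun g m ↦ ?_⟩
  have hj₂' : ∀ (g : absoluteGaloisGroup ℚ) (y : W₂.geomTorsion (p : ℤ)),
      j₂.symm (g • y) = g • j₂.symm y := by
    intro g y
    apply j₂.injective
    rw [j₂.apply_symm_apply]
    apply Subtype.ext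
    rw [hj₂g g (j₂.symm y), j₂.apply_symm_apply]
    rfl
  have hj₁' : j₁ (g • m) = g • j₁ m := Subtype.ext (hj₁ g m)
  rw [AddEquiv.trans_apply, AddEquiv.trans_apply, AddEquiv.trans_apply, AddEquiv.trans_apply, hj₁',
    he, hj₂']

/-! ## §2. The transfer for two congruent curves over `ℚ`, every hypothesis discharged -/

section Transfer

variable (W₁ W₂ : WeierstrassCurve ℚ) [W₁.IsElliptic] [W₁.IsGloballyMinimal] [W₂.IsElliptic]
  [W₂.IsGloballyMinimal] {p : ℕ} [Fact p.Prime] (κ : ZpExtension ℚ p)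
  (S₀ : Set (HeightOneSpectrum (𝓞 ℚ)))

/-- **"The order of `S^{Σ₀}_{A_i}(ℚ_∞)[p]` (corrected) is independent of `i`", fully discharged.**
`E₁, E₂/ℚ` globally minimal, `p` odd, both good ORDINARY at `p` (`p ∤ Δ`, `p ∤ a_p`), `κ`
cyclotomic, `Σ₀ ⊇` the bad primes `≠ p` of both, and a `Γ_ℚ`-equivariant `θ : E₁[p^∞][p] ≃ E₂[p^∞][p]`.
Then, for Greenberg's data `C_i = ker(E_i[p^∞] → Ẽ_i)`,
`#(S^{Σ₀}_{E₁[p^∞]}(ℚ_∞) ⊓ H¹[p]) = #(S^{Σ₀}_{E₂[p^∞]}(ℚ_∞) ⊓ H¹[p])`.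
[cite: GreenbergVatsal2000, §2 Prop. (2.8) and pp. 26–27] -/
theorem natCard_gvSelmerInfty_inf_torsion_eq (hp : p ≠ 2)
    (hgood₁ : W₁.HasGoodReductionAtPrime p) (hord₁ : ¬ (p : ℤ) ∣ W₁.frobeniusTrace p)
    (hgood₂ : W₂.HasGoodReductionAtPrime p) (hord₂ : ¬ (p : ℤ) ∣ W₂.frobeniusTrace p)
    (hκ : κ.IsCyclotomic)
    (hS₁ : ∀ v : HeightOneSpectrum (𝓞 ℚ), v ∉ S₀ → ((p : ℕ) : 𝓞 ℚ) ∉ v.asIdeal →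
      W₁.HasGoodReductionAt v)
    (hS₂ : ∀ v : HeightOneSpectrum (𝓞 ℚ), v ∉ S₀ → ((p : ℕ) : 𝓞 ℚ) ∉ v.asIdeal →
      W₂.HasGoodReductionAt v)
    (θ : (W₁.geomPrimaryTorsion p)[(p : ℤ)] ≃+ (W₂.geomPrimaryTorsion p)[(p : ℤ)])
    (hθ : ∀ (g : absoluteGaloisGroup ℚ) (m : (W₁.geomPrimaryTorsion p)[(p : ℤ)]),
      θ (g • m) = g • θ m) :
    Nat.card (gvSelmerInfty κ (W₁.geomPrimaryTorsion p)
        (reductionData W₁ p (W₁.not_dvd_minimalDiscriminantInt_of_hasGoodReductionAtPrime' p hgood₁))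
        S₀ ⊓ (subgroupH1 κ.kerSubgroup (W₁.geomPrimaryTorsion p))[(p : ℤ)] :
        AddSubgroup (subgroupH1 κ.kerSubgroup (W₁.geomPrimaryTorsion p))) =
      Nat.card (gvSelmerInfty κ (W₂.geomPrimaryTorsion p)
        (reductionData W₂ p (W₂.not_dvd_minimalDiscriminantInt_of_hasGoodReductionAtPrime' p hgood₂))
        S₀ ⊓ (subgroupH1 κ.kerSubgroup (W₂.geomPrimaryTorsion p))[(p : ℤ)] :
        AddSubgroup (subgroupH1 κ.kerSubgroup (W₂.geomPrimaryTorsion p))) := by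
  haveI : Finite (invariants κ.kerSubgroup (W₁.geomPrimaryTorsion p)) :=
    W₁.finite_fixedPoints_kerSubgroup_geomPrimaryTorsion_of_ordinary κ hp hgood₁ hord₁ hκ
  haveI : Finite (invariants κ.kerSubgroup (W₂.geomPrimaryTorsion p)) :=
    W₂.finite_fixedPoints_kerSubgroup_geomPrimaryTorsion_of_ordinary κ hp hgood₂ hord₂ hκ
  exact natCard_gvSelmer_inf_torsion_eq_of_inertia κ.kerSubgroup (W₁.geomPrimaryTorsion p)
    (W₂.geomPrimaryTorsion p) p _ _ S₀ p (continuous_smul_curve W₁ p) (continuous_smul_curve W₂ p)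
    (divisible_curve W₁ p) (divisible_curve W₂ p) (unramified_outside W₁ p S₀ hS₁)
    (unramified_outside W₂ p S₀ hS₂) (reductionData_htriv W₁ p _) (reductionData_htriv W₂ p _)
    (reductionData_hgen W₁ p hp _ hord₁) (reductionData_hgen W₂ p hp _ hord₂) θ hθ

/-- **The same from route G's `TorsionIso E₁ E₂ p`** (`X1.CongruenceTransfer.TorsionIso`: an
equivariant `E₁[p] ≅ E₂[p]` on the `p`-torsion of `E_i(ℚ̄)`; over `p = 3` decided per pair by
eisenstein-p1's key `(d, Kummer line)`). This is the kernel form of Greenberg–Vatsal's p. 27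
"the order of this group is independent of `i`", for two good-ordinary members, with NO `H⁰`
hypothesis, NO hypothesis on the data, and NO correction term.
[cite: GreenbergVatsal2000, §2 Prop. (2.8) and pp. 26–27] -/
theorem natCard_gvSelmerInfty_inf_torsion_eq_of_torsionIso (hp : p ≠ 2)
    (hgood₁ : W₁.HasGoodReductionAtPrime p) (hord₁ : ¬ (p : ℤ) ∣ W₁.frobeniusTrace p)
    (hgood₂ : W₂.HasGoodReductionAtPrime p) (hord₂ : ¬ (p : ℤ) ∣ W₂.frobeniusTrace p)
    (hκ : κ.IsCyclotomic)
    (hS₁ : ∀ v : HeightOneSpectrum (𝓞 ℚ), v ∉ S₀ → ((p : ℕ) : 𝓞 ℚ) ∉ v.asIdeal →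
      W₁.HasGoodReductionAt v)
    (hS₂ : ∀ v : HeightOneSpectrum (𝓞 ℚ), v ∉ S₀ → ((p : ℕ) : 𝓞 ℚ) ∉ v.asIdeal →
      W₂.HasGoodReductionAt v)
    (hiso : X1.CongruenceTransfer.TorsionIso W₁ W₂ p) :
    Nat.card (gvSelmerInfty κ (W₁.geomPrimaryTorsion p)
        (reductionData W₁ p (W₁.not_dvd_minimalDiscriminantInt_of_hasGoodReductionAtPrime' p hgood₁))
        S₀ ⊓ (subgroupH1 κ.kerSubgroup (W₁.geomPrimaryTorsion p))[(p : ℤ)] :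
        AddSubgroup (subgroupH1 κ.kerSubgroup (W₁.geomPrimaryTorsion p))) =
      Nat.card (gvSelmerInfty κ (W₂.geomPrimaryTorsion p)
        (reductionData W₂ p (W₂.not_dvd_minimalDiscriminantInt_of_hasGoodReductionAtPrime' p hgood₂))
        S₀ ⊓ (subgroupH1 κ.kerSubgroup (W₂.geomPrimaryTorsion p))[(p : ℤ)] :
        AddSubgroup (subgroupH1 κ.kerSubgroup (W₂.geomPrimaryTorsion p))) := by
  obtain ⟨θ, hθ⟩ := exists_equiv_of_torsionIso hiso
  exact natCard_gvSelmerInfty_inf_torsion_eq W₁ W₂ κ S₀ hp hgood₁ hord₁ hgood₂ hord₂ hκ hS₁ hS₂ θ hθ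

end Transfer

end Summit.BirchSwinnertonDyer.Rank1Residual.X2.GreenbergVatsalTransferCurve

end
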